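import Literature.NumberTheory.Rogawski1990.ArchOrbFamGExtJumpSideAssembly             -- ★ p850629∕p850677 (LH3-p02 (g3)): `exists_std_package`, `blockWeights_of_mem_splitChartPlaces`, `isCompact_map_circleDiagonal_range`; brings ★ `ArchOrbFamGExtJumpSide`
import Literature.NumberTheory.Rogawski1990.ArchChartOrbGBlockNormal                   -- ★ p850492 (F0P3-p02 (g18)): `eM_gprimeTorus_add_smul_hcNrm_eq` (`hγ`)
import Literature.NumberTheory.Rogawski1990.ArchChartOrbGBlockNormalBinders            -- ★ p850667 (F0P3-p02 (g18)): `exists_blockNormal_binders` (`hCMν`, `hintν`)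
import Literature.NumberTheory.Automorphic.ArchInnerFormSemiregularCentralizerBlockExplicit -- ★ p850499 (LH5-p02 (g3)): (M-UNFOLD) explicit edition, clauses [4]–[10]
import Literature.MeasureTheory.Group.HaarRightInvariantOfProductDecomposition         -- ★ p850728 (F0P2-p01 (g19)): `exists_isHaarMeasure_isMulRightInvariant_isInvInvariant_centralizer_arch`
import Literature.MeasureTheory.Group.InvariantQuotientBlockDescent                    -- ★ p850497 (LH3-p03 (g4)): `exists_smul_map_mk_of_block_compact` (the `hmap` of ★ p850417)
import Literature.NumberTheory.Rogawski1990.ArchChartOrbGBlockReduction                -- ★ p850417 (F0P3-p02 (g18)) (J-G′-BLOCK): `exists_block_testFunction_chartOrbG_eventuallyEq`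
import Literature.NumberTheory.Rogawski1990.ArchDescendedFunctionSmooth                -- ★ p850672 (F0P3a-p05 (g20)) (aM-SMOOTH): `exists_contDiff_descended_eq`
import Literature.NumberTheory.Automorphic.ArchBlockEmbeddingSmooth                    -- ★ (eM-SMOOTH) (F0P3a-p05 (g20)): `exists_contDiff_coe_symm_archPiEquivCM_mulSingle_relabel_endoEmb`
import Literature.NumberTheory.Rogawski1990.ArchOrbFamGExtJumpWall                     -- ★ p850367 (LH3-p02): (c-wall) `archERhoG_mul_archRG_add_smul_hcNrm_eq`, `wallFactorLimit_ne_zero_of_hcSemireg`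
import Literature.MeasureTheory.Group.OrbitalDescentNonneg                             -- ★ p850338 (LH5-p03): `exists_continuous_hasCompactSupport_integral_comp_mul_eq_one_pos`
import Literature.Analysis.Calculus.ContDiffCompactSupportCutoff                       -- ★ p840156: `exists_contDiff_hasCompactSupport_comp_eq` (ambient cut-off to compact support)
import Literature.NumberTheory.Rogawski1990.ArchInnerFormChartOrbIntegrable              -- ★ p850485 (F0P3a-p08 (g22)): `integrable_descConj_gprimeTorus_of_regG`; brings ★ SPLIT-DOCK p850470 `uniformlyProper_gprimeTorus_of_semireg_of_regular`, ★ D4b-1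
import Literature.NumberTheory.Rogawski1990.ArchCartanWallExtensionGDocks              -- ★ p850260: brings ★ `exists_nhds_hcSemireg` (the semiregular neighbourhood)
import Literature.NumberTheory.Automorphic.ArchInnerFormChartOrbitalSmooth               -- ★ p850500 (F0P3a-p05 (g20)): `contDiff_coe_gprimeTorus`
import HarnessLib

/-!
# (B-desc) PRODUCT-NEIGHBOURHOOD EDITION: the descent identity of the genuine `G′`-family on a whole NEIGHBOURHOOD of a semiregular noncompact-wall point
# — `chartOrbG(c) = K · ∫_{U(J)} f(c, h · P diag(e^{ic_{w₀0}}, e^{ic_{w₀2}}) P⁻¹ · h⁻¹) dμ₀` for all regular `c` near `p`, `f` jointly `C^∞`, `K ≠ 0`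
# (Rogawski 1990 §4.12 Lemma 4.12.1 «ONE φ for all x near 1», §8.2 pp. 119–124; Harish-Chandra–van Dijk 1970 I §3; Shelstad 1979 §4)

Topic `NumberTheory/Rogawski1990`; namespace `Literature.NumberTheory.Rogawski1990`.  THEOREMS ONLY (no `def`, no instance, no notation, no axiom, no named fact, no `sorry`);
kernel lane `--kind proof --supports stmt-HodgeConjecture-24833`.  Cell `pub/hodgecm-mathlib`, crux H413 (`stmt-HodgeConjecture-24833`), F0∕P3c line LH3 (closer stub `stub_N9`),
LETTER L1 clauses (I₃)∕(I₁) — LH3-plan (g3) RULING #15 «UNIFICATION (binding on (B-desc)): the descent identity ON A PRODUCT NEIGHBOURHOOD of a face point with a smooth family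
of test functions» (consumers: (B2) «faces with parameters» LH3-p02 (g4), (B-trans) F0P3a-p08 (g23), (I₁-faces) LH7-p04 (g4)); sequel of ★ p850981 `ArchOrbFamGExtNormalLineDescent`
(the one-variable edition along the normal line); author LH3-p04 (g4).

THE MATHEMATICS.  Same setting and SAME descent as ★ p850981 — at the ONE group element `s := γ_p = gprimeTorus α S p` (`p` semiregular on the noncompact wall `(w₀, 0, 2)`,
`w₀ ∉ S` covered, `S` admissible): Rogawski's Lemma 4.12.1 gives ONE cut-off `β` and ONE compact `C″` serving EVERY chart point `c` near `p` (★ D4b-1 on a compact BOX around `p`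
inside the semiregular neighbourhood ★ `exists_nhds_hcSemireg`, split places docked by ★ SPLIT-DOCK — §1, the box twin of ★ p850667 §1), ★ D4b `chartOrbG_eq_integral_descended_of_cutoff`
is pointwise in `c`, the torus `T_S` lies in `Z(γ_p)` for every `c`, and the block reading of `γ_c` through `e′ = (φ × id) ∘ e` is ★ p850499 [5]+[6]:
`e′ γ_c = (P · diag(e^{ic_{w₀0}}, e^{ic_{w₀2}}) · P⁻¹, r(c))`, **`r(c) = γ_{update c w₀ (0, c_{w₀1}, 0)}`** — a function of the TANGENTIAL coordinates only.  Hence (★ p850417 §1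
`integral_descConj_eq_smul_integral_of_block`, generic in `γ`):
  **`chartOrbG L α ν′ S a′ c = (dt′(B′)·κ) · ∫_{U(J)} f(c, ↑↑(h · P diag(e^{ic_{w₀0}}, e^{ic_{w₀2}}) P⁻¹ · h⁻¹)) dμ₀`  for all `c ∈ U ∩ RegG S`**,
with `f(c, X) = χ(X) · ΘM(Λ(M₀⁻¹ X M₀) · ↑↑γ_{update c w₀ (0,c_{w₀1},0)})` JOINTLY `C^∞` in `(c, X)` (★ (aM-SMOOTH) p850672, ★ (eM-SMOOTH), ★ `contDiff_coe_gprimeTorus`, `χ` a fixed smooth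
cut-off ≡ 1 on the common compact support `pr₁(e′(tsupport (a′)_M^β))`), compactly supported in `X` uniformly in `c`, and depending on `c` only through `update c w₀ (0, c_{w₀1}, 0)`.
On the normal line `c = p + ν • hcNrm w₀ 0 2` the torus element is `z·diag(e^{iν}, e^{−iν})` and `f(c, ·)` is constant in `ν` — the one-variable ★ p850981 is the special case.
HONEST LABEL: HC_CM is proved only modulo the 7 printed citations (2 remaining: hLiu418 = `stmt-HodgeConjecture-24832`, h413 = `stmt-HodgeConjecture-24833`) until rung 0 closes;
count-neutral assembly of ★ bricks; letter L1 stays a `sorry` of record until all its clauses are paid.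

## References
* [Rogawski1990] J. D. Rogawski, *Automorphic Representations of Unitary Groups in Three Variables*, Ann. of Math. Stud. 123 (1990), §4.12 Lemma 4.12.1 p. 66, §8.2 pp. 119–124.
* [HarishChandra1970] Harish-Chandra (notes by G. van Dijk), *Harmonic Analysis on Reductive p-adic Groups*, LNM 162 (1970), Part I §3 Lemmas 22–23.
* [Shelstad1979] D. Shelstad, *Characters and inner forms of a quasi-split group over ℝ*, Compositio Math. 39 (1979), §4 pp. 22–25.
* [Varadarajan1977] V. S. Varadarajan, *Harmonic Analysis on Real Reductive Groups*, LNM 576 (1977), Part I §1.12.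
-/

set_option autoImplicit false

noncomputable section

open MeasureTheory MeasureTheory.Measure NumberField NumberField.InfinitePlace NumberField.mixedEmbedding Matrix Complex Set Filter Topology
open scoped MatrixGroups Matrix Real Classical ENNReal NNReal ContDiff Matrix.Norms.Operator Pointwise
open Literature.NumberTheory.Automorphic Literature.NumberTheory.Automorphic.UnitaryGroup Literature.NumberTheory.Automorphic.ArchCartan
open Literature.NumberTheory.GaloisRepresentations Literature.MeasureTheory.Group

namespace Literature.NumberTheory.Rogawski1990

/-! ## §1 Harish-Chandra's compactness on a BOX around the semiregular point (the box twin of ★ p850667 §1) -/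

section Box

variable (L : Type) [Field L] [NumberField L] [IsCMField L] (α : Fin 3 → L)
  (S : Finset {w : InfinitePlace L // IsComplex w}) (w₀ : {w : InfinitePlace L // IsComplex w}) (p : {w : InfinitePlace L // IsComplex w} → Fin 3 → ℝ)

/-- **ONE COMPACT `C″` FOR ALL CHART POINTS NEAR A SEMIREGULAR WALL POINT** (Rogawski's Lemma 4.12.1 «for all `x` in a neighbourhood of `1` in `M`»): there are a compact `C″ ⊆ G′_∞` and
an open `U ∋ p` inside the semiregular neighbourhood (regular at the other compact places, `x ≠ 0` at the split places) such that for EVERY `c ∈ U`: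
`y′ · gprimeTorus c · y′⁻¹ ∈ C′ ⇒ y′ ∈ C″ · Z(gprimeTorus p)` — ★ D4b-1 on a compact ball around `p` (★ SPLIT-DOCK at the split places), lifted to the group.
[cite: Rogawski1990, §4.12 Lemma 4.12.1 p. 66; §8.2 p. 122] [cite: HarishChandra1970, Part I §3 Lemma 22] [cite: Shelstad1979, §4 pp. 22–25] -/
theorem exists_isCompact_mul_centralizer_box_hcSemireg (hα : ∀ i, α i ≠ 0)
    (hreal : ∀ (w : {w : InfinitePlace L // IsComplex w}) (i : Fin 3), (w.1.embedding (α i)).im = 0)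
    (hS : ∀ w, w ∈ S → w ∈ splitChartPlaces L α) (hw₀ : w₀ ∉ S) (hp : HcSemireg S w₀ 0 2 p)
    {C' : Set ↥(arch (↥(maximalRealSubfield L)) L (IsCMField.complexConj L) 3 (Matrix.diagonal α))} (hC' : IsCompact C') :
    ∃ (C'' : Set ↥(arch (↥(maximalRealSubfield L)) L (IsCMField.complexConj L) 3 (Matrix.diagonal α))) (U : Set ({w : InfinitePlace L // IsComplex w} → Fin 3 → ℝ)),
      IsCompact C'' ∧ IsOpen U ∧ p ∈ U ∧
      (∀ c ∈ U, ∀ w, w ∉ S → w ≠ w₀ → Function.Injective fun l : Fin 3 => Circle.exp (c w l)) ∧ (∀ c ∈ U, ∀ w ∈ S, c w 0 ≠ 0) ∧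
      ∀ c ∈ U, ∀ y' : ↥(arch (↥(maximalRealSubfield L)) L (IsCMField.complexConj L) 3 (Matrix.diagonal α)),
        y' * gprimeTorus L α S c * y'⁻¹ ∈ C' →
          y' ∈ C'' * ((Subgroup.centralizer ({gprimeTorus L α S p} : Set ↥(arch (↥(maximalRealSubfield L)) L (IsCMField.complexConj L) 3 (Matrix.diagonal α)))) :
            Set ↥(arch (↥(maximalRealSubfield L)) L (IsCMField.complexConj L) 3 (Matrix.diagonal α))) := by
  -- adapted from ★ p850667 `exists_isCompact_mul_centralizer_nhds_hcSemireg` (F0P3-p02 (g18)): compact normal segment ↦ compact ball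
  have h02 : (0 : Fin 3) ≠ 2 := by decide
  obtain ⟨U, hUo, hpU, -, -, hU2, hU3, hU4⟩ := exists_nhds_hcSemireg hw₀ h02 hp
  obtain ⟨ε, hε, hball⟩ := Metric.isOpen_iff.1 hUo p hpU
  have hKc : IsCompact (Metric.closedBall p (ε / 2)) := isCompact_closedBall p (ε / 2)
  have hKU : Metric.closedBall p (ε / 2) ⊆ U := (Metric.closedBall_subset_ball (by linarith)).trans hball
  have hKS : Metric.closedBall p (ε / 2) ⊆ Set.pi Set.univ
      (fun w : {w : InfinitePlace L // IsComplex w} => {cw : Fin 3 → ℝ |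
        (w = w₀ → ∀ j : Fin 3, j ≠ 1 → Circle.exp (cw 1) ≠ Circle.exp (cw j)) ∧
        (w ∉ S → w ≠ w₀ → Function.Injective fun l : Fin 3 => Circle.exp (cw l)) ∧ (w ∈ S → cw 0 ≠ 0)}) := by
    intro c hc w _
    have hcU : c ∈ U := hKU hc
    refine ⟨fun hw j hj => ?_, fun hwS hww => hU3 c hcU w hwS hww, fun hwS => hU4 c hcU w hwS⟩
    rw [hw]
    have h1 := hU2 c hcU 1 (by decide) (by decide)
    fin_cases j
    · exact h1.1
    · exact absurd rfl hj
    · exact h1.2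
  have hkey : ∀ j : Fin 3, j ≠ 1 → Circle.exp (p w₀ j) = Circle.exp (p w₀ 0) := by
    intro j hj
    fin_cases j
    · rfl
    · exact absurd rfl hj
    · exact congrArg Circle.exp hp.1.symm
  have hwall : ∀ j j' : Fin 3, j ≠ 1 → j' ≠ 1 → Circle.exp (p w₀ j) = Circle.exp (p w₀ j') :=
    fun j j' hj hj' => (hkey j hj).trans (hkey j' hj').symm
  have hw₀' : ¬ (w₀ ∈ S ∧ w₀ ∈ splitChartPlaces L α) := fun h => hw₀ h.1
  have hpS : ∀ w, w ∈ S ∧ w ∈ splitChartPlaces L α → p w 0 ≠ 0 := fun w hw => hp.2.2.2 w hw.1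
  obtain ⟨𝒦', h𝒦', hmem𝒦⟩ := uniformlyProper_gprimeTorus_of_semireg_of_regular L α S hα hreal p w₀ hw₀' 1 hwall hpS
    (fun w : {w : InfinitePlace L // IsComplex w} => {cw : Fin 3 → ℝ |
        (w = w₀ → ∀ j : Fin 3, j ≠ 1 → Circle.exp (cw 1) ≠ Circle.exp (cw j)) ∧
        (w ∉ S → w ≠ w₀ → Function.Injective fun l : Fin 3 => Circle.exp (cw l)) ∧ (w ∈ S → cw 0 ≠ 0)})
    (fun cw hcw => hcw.1 rfl) (fun w hw hws cw hcw => hcw.2.1 (fun hwS => hws ⟨hwS, hS w hwS⟩) hw) (fun w hws cw hcw => hcw.2.2 hws.1)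
    _ hKS hKc C' hC'
  obtain ⟨C'', hC'', hsub⟩ := exists_isCompact_image_mk_superset
    (Subgroup.centralizer ({gprimeTorus L α S p} : Set ↥(arch (↥(maximalRealSubfield L)) L (IsCMField.complexConj L) 3 (Matrix.diagonal α)))) h𝒦'
  refine ⟨C'', Metric.ball p (ε / 2), hC'', Metric.isOpen_ball, Metric.mem_ball_self (half_pos hε),
    fun c hc w hw hww => hU3 c (hKU (Metric.ball_subset_closedBall hc)) w hw hww, fun c hc w hw => hU4 c (hKU (Metric.ball_subset_closedBall hc)) w hw, ?_⟩
  intro c hc y' hy'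
  obtain ⟨a, ha, hay⟩ := hsub (hmem𝒦 _ (Metric.ball_subset_closedBall hc) y' hy')
  rw [QuotientGroup.eq] at hay
  exact ⟨a, ha, a⁻¹ * y', hay, by group⟩

end Box

/-! ## §2 The descent identity on the box, with a jointly smooth family of block test functions -/

section Chart

variable (L : Type) [Field L] [NumberField L] [IsCMField L] (α : Fin 3 → L)
  [MeasurableSpace ↥(arch (↥(maximalRealSubfield L)) L (IsCMField.complexConj L) 3 (Matrix.diagonal α))]
  [BorelSpace ↥(arch (↥(maximalRealSubfield L)) L (IsCMField.complexConj L) 3 (Matrix.diagonal α))]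
  (ν' : Measure ↥(arch (↥(maximalRealSubfield L)) L (IsCMField.complexConj L) 3 (Matrix.diagonal α))) [ν'.IsHaarMeasure] [ν'.IsMulRightInvariant]

set_option maxHeartbeats 1600000 in
/-- **(B-desc) PRODUCT-NEIGHBOURHOOD EDITION.**  House frame, admissible compact chart `S`, covered compact place `w₀ ∉ S`, semiregular point `p` of the wall `(w₀, 0, 2)`, `a′ ∈ C_c^∞(G′_∞)`,
any Haar `μ₀` on `U(J)`: there are `K ≠ 0`, an open `U ∋ p` and a JOINTLY SMOOTH family `f : (coordinates) × M₂(ℂ) → ℂ`, compactly supported in the matrix variable uniformly in `c`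
and depending on `c` only through the tangential coordinates `update c w₀ (0, c_{w₀1}, 0)`, such that for every `c ∈ U ∩ RegG S`
**`chartOrbG L α ν′ S a′ c = K · ∫_{U(J)} f(c, ↑↑(h · P diag(e^{i c_{w₀0}}, e^{i c_{w₀2}}) P⁻¹ · h⁻¹)) dμ₀(h)`** (`P = (1 1; 1 −1)`; ★ p850353's Cayley torus element at the pair
`(e^{i c_{w₀0}}, e^{i c_{w₀2}})`). [cite: Rogawski1990, §4.12 Lemma 4.12.1 p. 66; §8.2 pp. 119–124] [cite: HarishChandra1970, Part I §3 Lemma 22] [cite: Shelstad1979, §4 Lemma 4.3 (p. 25)] -/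
theorem exists_descent_box_chartOrbG (hα : ∀ i, α i ≠ 0)
    (hreal : ∀ (w : {w : InfinitePlace L // IsComplex w}) (i : Fin 3), (w.1.embedding (α i)).im = 0)
    {J : Matrix (Fin 2) (Fin 2) ℂ} (hJ : J = (StdForm.antidiagonal 2).over ℂ)
    [MeasurableSpace ↥(unitaryGroupOfForm (starRingEnd ℂ) J)] [BorelSpace ↥(unitaryGroupOfForm (starRingEnd ℂ) J)]
    [LocallyCompactSpace ↥(unitaryGroupOfForm (starRingEnd ℂ) J)] [SecondCountableTopology ↥(unitaryGroupOfForm (starRingEnd ℂ) J)]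
    (μ₀ : Measure ↥(unitaryGroupOfForm (starRingEnd ℂ) J)) [μ₀.IsHaarMeasure] [μ₀.IsMulRightInvariant]
    {S : Finset {w : InfinitePlace L // IsComplex w}} {w₀ : {w : InfinitePlace L // IsComplex w}} {p : {w : InfinitePlace L // IsComplex w} → Fin 3 → ℝ}
    (hS : ∀ w, w ∈ S → w ∈ splitChartPlaces L α) (hw₀ : w₀ ∉ S) (hwsp : w₀ ∈ splitChartPlaces L α) (hp : HcSemireg S w₀ 0 2 p)
    {a' : ↥(arch (↥(maximalRealSubfield L)) L (IsCMField.complexConj L) 3 (Matrix.diagonal α)) → ℂ} (ha' : ArchSmooth L 3 (Matrix.diagonal α) a') :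
    ∃ (K : ℂ) (U : Set ({w : InfinitePlace L // IsComplex w} → Fin 3 → ℝ)) (f : ({w : InfinitePlace L // IsComplex w} → Fin 3 → ℝ) × Matrix (Fin 2) (Fin 2) ℂ → ℂ),
      K ≠ 0 ∧ IsOpen U ∧ p ∈ U ∧ ContDiff ℝ ∞ f ∧
      (∃ C : Set (Matrix (Fin 2) (Fin 2) ℂ), IsCompact C ∧ ∀ c X, X ∉ C → f (c, X) = 0) ∧
      (∀ c X, f (c, X) = f (Function.update c w₀ ![0, c w₀ 1, 0], X)) ∧
      ∀ c ∈ U ∩ RegG S, chartOrbG L α ν' S a' c =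
        K * ∫ h : ↥(unitaryGroupOfForm (starRingEnd ℂ) J),
          f (c, (((h * ⟨Matrix.GeneralLinearGroup.mkOfDetNeZero !![(1 : ℂ), 1; 1, -1] det_cayleyTwo_ne_zero *
                circleDiagonal 2 ![Circle.exp (c w₀ 0), Circle.exp (c w₀ 2)] *
                (Matrix.GeneralLinearGroup.mkOfDetNeZero !![(1 : ℂ), 1; 1, -1] det_cayleyTwo_ne_zero)⁻¹,
              cayley_conj_circleDiagonal_mem_of_eq_over hJ _⟩ * h⁻¹ : ↥(unitaryGroupOfForm (starRingEnd ℂ) J)) : GL (Fin 2) ℂ) : Matrix (Fin 2) (Fin 2) ℂ)) ∂μ₀ := by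
  -- ### frame facts
  have ha'c : Continuous a' := ha'.continuous
  have ha's : HasCompactSupport a' := ha'.hasCompactSupport
  obtain ⟨hreal2, hsgn⟩ := blockWeights_of_mem_splitChartPlaces L α w₀ hwsp
  have hs02 : p w₀ 0 = p w₀ 2 := hp.1
  have h02c : Circle.exp (p w₀ 0) = Circle.exp (p w₀ 2) := by rw [hs02]
  have h01 : Circle.exp (p w₀ 0) ≠ Circle.exp (p w₀ 1) := by
    intro h; have h2 := hp.2.1; rw [hcThird_zero_two] at h2; exact h2 h.symm
  have hreg : ∀ w, w ≠ w₀ → w ∉ S → Function.Injective fun i : Fin 3 => Circle.exp (p w i) := fun w hne hw => hp.2.2.1 w hw hne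
  have hregS : ∀ w, w ∈ S → p w 0 ≠ 0 := hp.2.2.2
  -- ### (M-UNFOLD), explicit edition (★ p850499): `e : Z(γ_p) ≃ₜ* B × K` with clauses [4]–[10]
  refine (exists_continuousMulEquiv_centralizer_gprimeTorus_semireg_explicit L α S w₀ hα hS hw₀ p h02c h01 hreg hregS).elim fun K hK => hK.elim fun e he => ?_
  obtain ⟨hKc, hKsub, hKcomm, h4, h5, h6, hmapT, h8, h9, h10⟩ := he
  -- ### (B-STD) package: `φ`, `e′`, `Ψ` (★ `exists_std_package`)
  refine (exists_std_package L α w₀ hJ hreal2 hsgn e _ _ hmapT).elim fun φ hφ => hφ.elim fun e' hY => hY.elim fun Ψ hZ => ?_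
  have hφ := hZ.1
  have hval := hZ.2.1
  have he' := hZ.2.2.1
  have hmapT' := hZ.2.2.2.1
  have hmem := hZ.2.2.2.2.1
  have hΨ := hZ.2.2.2.2.2.2
  -- ### the chart torus sits inside `Z(γ_p)`
  have hT : chartTorusG L α S ≤ Subgroup.centralizer ({gprimeTorus L α S p} : Set ↥(arch (↥(maximalRealSubfield L)) L (IsCMField.complexConj L) 3 (Matrix.diagonal α))) :=
    chartTorusG_le_centralizer L α S p
  -- ### instances on `Z(γ_p)`, its quotient, `K`, `U(J) ⧸ φ(A)`
  have hZc : IsClosed ((Subgroup.centralizer ({gprimeTorus L α S p} : Set ↥(arch (↥(maximalRealSubfield L)) L (IsCMField.complexConj L) 3 (Matrix.diagonal α)))) :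
      Set ↥(arch (↥(maximalRealSubfield L)) L (IsCMField.complexConj L) 3 (Matrix.diagonal α))) := isClosed_centralizer_singleton_of_t2 _
  haveI : LocallyCompactSpace ↥(Subgroup.centralizer ({gprimeTorus L α S p} : Set ↥(arch (↥(maximalRealSubfield L)) L (IsCMField.complexConj L) 3 (Matrix.diagonal α)))) := hZc.isClosedEmbedding_subtypeVal.locallyCompactSpace
  haveI : SecondCountableTopology ↥(Subgroup.centralizer ({gprimeTorus L α S p} : Set ↥(arch (↥(maximalRealSubfield L)) L (IsCMField.complexConj L) 3 (Matrix.diagonal α)))) := TopologicalSpace.Subtype.secondCountableTopology _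
  letI : MeasurableSpace (↥(Subgroup.centralizer ({gprimeTorus L α S p} : Set ↥(arch (↥(maximalRealSubfield L)) L (IsCMField.complexConj L) 3 (Matrix.diagonal α)))) ⧸ (chartTorusG L α S).subgroupOf (Subgroup.centralizer ({gprimeTorus L α S p} : Set ↥(arch (↥(maximalRealSubfield L)) L (IsCMField.complexConj L) 3 (Matrix.diagonal α))))) := borel _
  haveI : BorelSpace (↥(Subgroup.centralizer ({gprimeTorus L α S p} : Set ↥(arch (↥(maximalRealSubfield L)) L (IsCMField.complexConj L) 3 (Matrix.diagonal α)))) ⧸ (chartTorusG L α S).subgroupOf (Subgroup.centralizer ({gprimeTorus L α S p} : Set ↥(arch (↥(maximalRealSubfield L)) L (IsCMField.complexConj L) 3 (Matrix.diagonal α))))) := ⟨rfl⟩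
  haveI : LocallyCompactSpace ↥K := hKc.isClosedEmbedding_subtypeVal.locallyCompactSpace
  haveI : SecondCountableTopology ↥K := TopologicalSpace.Subtype.secondCountableTopology _
  letI : MeasurableSpace ↥K := borel _
  haveI : BorelSpace ↥K := ⟨rfl⟩
  letI : MeasurableSpace (↥(unitaryGroupOfForm (starRingEnd ℂ) J) ⧸ Subgroup.map (φ : ↥(unitaryGroupOfForm (starRingEnd ℂ) ((Matrix.diagonal ![α (lineOf (formSign L α w₀) 0), α (lineOf (formSign L α w₀) 2)]).map w₀.1.embedding)) →* ↥(unitaryGroupOfForm (starRingEnd ℂ) J)) ((circleDiagonal 2).codRestrict (unitaryGroupOfForm (starRingEnd ℂ) ((Matrix.diagonal ![α (lineOf (formSign L α w₀) 0), α (lineOf (formSign L α w₀) 2)]).map w₀.1.embedding)) (circleDiagonal_mem_archLocal_diagonal L 2 ![α (lineOf (formSign L α w₀) 0), α (lineOf (formSign L α w₀) 2)] w₀)).range) := borel _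
  haveI : BorelSpace (↥(unitaryGroupOfForm (starRingEnd ℂ) J) ⧸ Subgroup.map (φ : ↥(unitaryGroupOfForm (starRingEnd ℂ) ((Matrix.diagonal ![α (lineOf (formSign L α w₀) 0), α (lineOf (formSign L α w₀) 2)]).map w₀.1.embedding)) →* ↥(unitaryGroupOfForm (starRingEnd ℂ) J)) ((circleDiagonal 2).codRestrict (unitaryGroupOfForm (starRingEnd ℂ) ((Matrix.diagonal ![α (lineOf (formSign L α w₀) 0), α (lineOf (formSign L α w₀) 2)]).map w₀.1.embedding)) (circleDiagonal_mem_archLocal_diagonal L 2 ![α (lineOf (formSign L α w₀) 0), α (lineOf (formSign L α w₀) 2)] w₀)).range) := ⟨rfl⟩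
  haveI : CompactSpace ↥(Subgroup.map (φ : ↥(unitaryGroupOfForm (starRingEnd ℂ) ((Matrix.diagonal ![α (lineOf (formSign L α w₀) 0), α (lineOf (formSign L α w₀) 2)]).map w₀.1.embedding)) →* ↥(unitaryGroupOfForm (starRingEnd ℂ) J)) ((circleDiagonal 2).codRestrict (unitaryGroupOfForm (starRingEnd ℂ) ((Matrix.diagonal ![α (lineOf (formSign L α w₀) 0), α (lineOf (formSign L α w₀) 2)]).map w₀.1.embedding)) (circleDiagonal_mem_archLocal_diagonal L 2 ![α (lineOf (formSign L α w₀) 0), α (lineOf (formSign L α w₀) 2)] w₀)).range) := isCompact_iff_compactSpace.mp (isCompact_map_circleDiagonal_range L α w₀ φ)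
  have hAcomm : ∀ a b : ↥(Subgroup.map (φ : ↥(unitaryGroupOfForm (starRingEnd ℂ) ((Matrix.diagonal ![α (lineOf (formSign L α w₀) 0), α (lineOf (formSign L α w₀) 2)]).map w₀.1.embedding)) →* ↥(unitaryGroupOfForm (starRingEnd ℂ) J)) ((circleDiagonal 2).codRestrict (unitaryGroupOfForm (starRingEnd ℂ) ((Matrix.diagonal ![α (lineOf (formSign L α w₀) 0), α (lineOf (formSign L α w₀) 2)]).map w₀.1.embedding)) (circleDiagonal_mem_archLocal_diagonal L 2 ![α (lineOf (formSign L α w₀) 0), α (lineOf (formSign L α w₀) 2)] w₀)).range), a * b = b * a := by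
    rintro ⟨_, ⟨x, ⟨u, rfl⟩, rfl⟩⟩ ⟨_, ⟨y, ⟨v, rfl⟩, rfl⟩⟩
    apply Subtype.ext
    show (φ : ↥(unitaryGroupOfForm (starRingEnd ℂ) ((Matrix.diagonal ![α (lineOf (formSign L α w₀) 0), α (lineOf (formSign L α w₀) 2)]).map w₀.1.embedding)) →* ↥(unitaryGroupOfForm (starRingEnd ℂ) J)) _ * (φ : ↥(unitaryGroupOfForm (starRingEnd ℂ) ((Matrix.diagonal ![α (lineOf (formSign L α w₀) 0), α (lineOf (formSign L α w₀) 2)]).map w₀.1.embedding)) →* ↥(unitaryGroupOfForm (starRingEnd ℂ) J)) _ =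
      (φ : ↥(unitaryGroupOfForm (starRingEnd ℂ) ((Matrix.diagonal ![α (lineOf (formSign L α w₀) 0), α (lineOf (formSign L α w₀) 2)]).map w₀.1.embedding)) →* ↥(unitaryGroupOfForm (starRingEnd ℂ) J)) _ * (φ : ↥(unitaryGroupOfForm (starRingEnd ℂ) ((Matrix.diagonal ![α (lineOf (formSign L α w₀) 0), α (lineOf (formSign L α w₀) 2)]).map w₀.1.embedding)) →* ↥(unitaryGroupOfForm (starRingEnd ℂ) J)) _
    rw [← map_mul, ← map_mul, ← map_mul, ← map_mul, mul_comm u v]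
  -- ### a right- and inversion-invariant Haar measure on `Z(γ_p)` (★ p850728)
  obtain ⟨νM, hνM1, hνM2, hνM3⟩ := exists_isHaarMeasure_isMulRightInvariant_isInvInvariant_centralizer_arch (↥(maximalRealSubfield L)) L (IsCMField.complexConj L) 3
    (Matrix.diagonal α) ({gprimeTorus L α S p} : Set ↥(arch (↥(maximalRealSubfield L)) L (IsCMField.complexConj L) 3 (Matrix.diagonal α))) K hKc hKcomm e' μ₀
  haveI := hνM1; haveI := hνM2; haveI := hνM3
  -- ### the descent scalar `κ`: `Ψ_*(νM ∕ dt′) = κ • π_* μ₀` (★ `exists_smul_map_mk_of_block_compact`)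
  haveI := isHaarMeasure_chartHaarG L α S
  haveI := isInvInvariant_chartHaarG L α S
  haveI := isHaarMeasure_map_subgroupOfEquivOfLe_symm hT (chartHaarG L α S)
  haveI := isInvInvariant_map_subgroupOfEquivOfLe_symm hT (chartHaarG L α S)
  have hTc := isClosed_subgroupOf_of_isClosed _ (Subgroup.centralizer ({gprimeTorus L α S p} : Set ↥(arch (↥(maximalRealSubfield L)) L (IsCMField.complexConj L) 3 (Matrix.diagonal α))))
    (isClosed_chartTorusG L α S)
  have hAcpt : IsCompact ((Subgroup.map (φ : ↥(unitaryGroupOfForm (starRingEnd ℂ) ((Matrix.diagonal ![α (lineOf (formSign L α w₀) 0), α (lineOf (formSign L α w₀) 2)]).map w₀.1.embedding)) →* ↥(unitaryGroupOfForm (starRingEnd ℂ) J)) ((circleDiagonal 2).codRestrict (unitaryGroupOfForm (starRingEnd ℂ) ((Matrix.diagonal ![α (lineOf (formSign L α w₀) 0), α (lineOf (formSign L α w₀) 2)]).map w₀.1.embedding)) (circleDiagonal_mem_archLocal_diagonal L 2 ![α (lineOf (formSign L α w₀) 0), α (lineOf (formSign L α w₀) 2)] w₀)).range) :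
      Set ↥(unitaryGroupOfForm (starRingEnd ℂ) J)) := isCompact_iff_compactSpace.mpr inferInstance
  have hA : IsClosed ((Subgroup.map (φ : ↥(unitaryGroupOfForm (starRingEnd ℂ) ((Matrix.diagonal ![α (lineOf (formSign L α w₀) 0), α (lineOf (formSign L α w₀) 2)]).map w₀.1.embedding)) →* ↥(unitaryGroupOfForm (starRingEnd ℂ) J)) ((circleDiagonal 2).codRestrict (unitaryGroupOfForm (starRingEnd ℂ) ((Matrix.diagonal ![α (lineOf (formSign L α w₀) 0), α (lineOf (formSign L α w₀) 2)]).map w₀.1.embedding)) (circleDiagonal_mem_archLocal_diagonal L 2 ![α (lineOf (formSign L α w₀) 0), α (lineOf (formSign L α w₀) 2)] w₀)).range) :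
      Set ↥(unitaryGroupOfForm (starRingEnd ℂ) J)) := hAcpt.isClosed
  letI : CommGroup ↥K := { (inferInstance : Group ↥K) with mul_comm := fun a b => Subtype.ext (hKcomm _ a.2 _ b.2) }
  let νK : Measure ↥K := haarMeasure (Classical.arbitrary (TopologicalSpace.PositiveCompacts ↥K))
  haveI : νK.IsInvInvariant := IsHaarMeasure.isInvInvariant_of_regular νK
  haveI : νK.IsMulRightInvariant := isMulRightInvariant_of_isInvInvariant νK
  letI : CommGroup ↥(Subgroup.map (φ : ↥(unitaryGroupOfForm (starRingEnd ℂ) ((Matrix.diagonal ![α (lineOf (formSign L α w₀) 0), α (lineOf (formSign L α w₀) 2)]).map w₀.1.embedding)) →* ↥(unitaryGroupOfForm (starRingEnd ℂ) J)) ((circleDiagonal 2).codRestrict (unitaryGroupOfForm (starRingEnd ℂ) ((Matrix.diagonal ![α (lineOf (formSign L α w₀) 0), α (lineOf (formSign L α w₀) 2)]).map w₀.1.embedding)) (circleDiagonal_mem_archLocal_diagonal L 2 ![α (lineOf (formSign L α w₀) 0), α (lineOf (formSign L α w₀) 2)] w₀)).range) :=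
    { (inferInstance : Group _) with mul_comm := hAcomm }
  let ρA : Measure ↥(Subgroup.map (φ : ↥(unitaryGroupOfForm (starRingEnd ℂ) ((Matrix.diagonal ![α (lineOf (formSign L α w₀) 0), α (lineOf (formSign L α w₀) 2)]).map w₀.1.embedding)) →* ↥(unitaryGroupOfForm (starRingEnd ℂ) J)) ((circleDiagonal 2).codRestrict (unitaryGroupOfForm (starRingEnd ℂ) ((Matrix.diagonal ![α (lineOf (formSign L α w₀) 0), α (lineOf (formSign L α w₀) 2)]).map w₀.1.embedding)) (circleDiagonal_mem_archLocal_diagonal L 2 ![α (lineOf (formSign L α w₀) 0), α (lineOf (formSign L α w₀) 2)] w₀)).range) :=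
    haarMeasure (Classical.arbitrary (TopologicalSpace.PositiveCompacts _))
  haveI : ρA.IsInvInvariant := IsHaarMeasure.isInvInvariant_of_regular ρA
  obtain ⟨κ, hκ, hmap, -⟩ := exists_smul_map_mk_of_block_compact e' ((chartTorusG L α S).subgroupOf _) hTc _ hA hmem Ψ hΨ
    (Measure.map (Subgroup.subgroupOfEquivOfLe hT).symm (chartHaarG L α S)) νM ρA μ₀ νK
  -- ### Harish-Chandra's compactness on a box around `p` (§1) and ONE cut-off `β` (★ p850338)
  obtain ⟨CS, U, hCSc, hUo, hpU, hUreg, hUx, hCM⟩ := exists_isCompact_mul_centralizer_box_hcSemireg L α S w₀ p hα hreal hS hw₀ hp ha's.isCompact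
  obtain ⟨β, hβc, hβs, hβ0, -, hβ1⟩ := exists_continuous_hasCompactSupport_integral_comp_mul_eq_one_pos
    (Subgroup.centralizer ({gprimeTorus L α S p} : Set ↥(arch (↥(maximalRealSubfield L)) L (IsCMField.complexConj L) 3 (Matrix.diagonal α)))) hZc νM (hCSc.insert 1)
  have hβ1S : ∀ x ∈ CS, ∀ k₀ : ↥(Subgroup.centralizer ({gprimeTorus L α S p} : Set ↥(arch (↥(maximalRealSubfield L)) L (IsCMField.complexConj L) 3 (Matrix.diagonal α)))), ∫ h : ↥(Subgroup.centralizer ({gprimeTorus L α S p} : Set ↥(arch (↥(maximalRealSubfield L)) L (IsCMField.complexConj L) 3 (Matrix.diagonal α)))), β (x * (k₀ : ↥(arch (↥(maximalRealSubfield L)) L (IsCMField.complexConj L) 3 (Matrix.diagonal α))) *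
      (h : ↥(arch (↥(maximalRealSubfield L)) L (IsCMField.complexConj L) 3 (Matrix.diagonal α)))) ∂νM = 1 :=
    fun x hx k₀ => hβ1 x (Set.mem_insert_of_mem _ hx) k₀
  -- ### the descended function `(a′)_M^β` (continuous, compactly supported) and its SMOOTH ambient reading (★ aM-SMOOTH, ★ eM-SMOOTH, φ's frame matrix)
  have haMc : Continuous fun m : ↥(Subgroup.centralizer ({gprimeTorus L α S p} : Set ↥(arch (↥(maximalRealSubfield L)) L (IsCMField.complexConj L) 3 (Matrix.diagonal α)))) =>
      ∫ x, β x • a' (x * (m : ↥(arch (↥(maximalRealSubfield L)) L (IsCMField.complexConj L) 3 (Matrix.diagonal α))) * x⁻¹) ∂ν' :=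
    continuous_integral_conj_subtype ν' _ hβc hβs ha'c
  have haMs : HasCompactSupport fun m : ↥(Subgroup.centralizer ({gprimeTorus L α S p} : Set ↥(arch (↥(maximalRealSubfield L)) L (IsCMField.complexConj L) 3 (Matrix.diagonal α)))) =>
      ∫ x, β x • a' (x * (m : ↥(arch (↥(maximalRealSubfield L)) L (IsCMField.complexConj L) 3 (Matrix.diagonal α))) * x⁻¹) ∂ν' :=
    hasCompactSupport_integral_conj ν' _ hZc hβs ha's
  obtain ⟨ΘM, hΘM, haM⟩ := exists_contDiff_descended_eq L 3 (Matrix.diagonal α) ν' ha' β hβc hβs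
    (Subgroup.centralizer ({gprimeTorus L α S p} : Set ↥(arch (↥(maximalRealSubfield L)) L (IsCMField.complexConj L) 3 (Matrix.diagonal α))))
  obtain ⟨Λ, hΛ, hΛb⟩ := exists_contDiff_coe_symm_archPiEquivCM_mulSingle_relabel_endoEmb L α w₀ (lineOf (formSign L α w₀))
  have hΛb' : ∀ b : ↥(unitaryGroupOfForm (starRingEnd ℂ) ((Matrix.diagonal ![α (lineOf (formSign L α w₀) 0), α (lineOf (formSign L α w₀) 2)]).map w₀.1.embedding)),
      ((((e.symm (b, 1) : ↥(Subgroup.centralizer ({gprimeTorus L α S p} : Set ↥(arch (↥(maximalRealSubfield L)) L (IsCMField.complexConj L) 3 (Matrix.diagonal α))))) :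
          ↥(arch (↥(maximalRealSubfield L)) L (IsCMField.complexConj L) 3 (Matrix.diagonal α))) : GL (Fin 3) (mixedSpace L)) : Matrix (Fin 3) (Fin 3) (mixedSpace L)) =
        Λ ((b : GL (Fin 2) ℂ) : Matrix (Fin 2) (Fin 2) ℂ) := fun b => by
    rw [h8 b]; exact hΛb b
  obtain ⟨M₀, hM₀⟩ : ∃ M₀ : GL (Fin 2) ℂ, ∀ h : ↥(unitaryGroupOfForm (starRingEnd ℂ) ((Matrix.diagonal ![α (lineOf (formSign L α w₀) 0), α (lineOf (formSign L α w₀) 2)]).map w₀.1.embedding)),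
      ((φ h : ↥(unitaryGroupOfForm (starRingEnd ℂ) J)) : GL (Fin 2) ℂ) = M₀ * (h : GL (Fin 2) ℂ) * M₀⁻¹ :=
    ⟨_, fun h => by rw [hval h, _root_.mul_inv_rev]⟩
  have hφsymm : ∀ u : ↥(unitaryGroupOfForm (starRingEnd ℂ) J),
      (((φ.symm u : ↥(unitaryGroupOfForm (starRingEnd ℂ) ((Matrix.diagonal ![α (lineOf (formSign L α w₀) 0), α (lineOf (formSign L α w₀) 2)]).map w₀.1.embedding))) : GL (Fin 2) ℂ) : Matrix (Fin 2) (Fin 2) ℂ) =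
        ((M₀⁻¹ : GL (Fin 2) ℂ) : Matrix (Fin 2) (Fin 2) ℂ) * ((u : GL (Fin 2) ℂ) : Matrix (Fin 2) (Fin 2) ℂ) * ((M₀ : GL (Fin 2) ℂ) : Matrix (Fin 2) (Fin 2) ℂ) := fun u => by
    have h := hM₀ (φ.symm u)
    rw [ContinuousMulEquiv.apply_symm_apply] at h
    have h' : ((φ.symm u : ↥(unitaryGroupOfForm (starRingEnd ℂ) ((Matrix.diagonal ![α (lineOf (formSign L α w₀) 0), α (lineOf (formSign L α w₀) 2)]).map w₀.1.embedding))) : GL (Fin 2) ℂ) =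
        M₀⁻¹ * (u : GL (Fin 2) ℂ) * M₀ := by
      rw [h]; group
    rw [h', Units.val_mul, Units.val_mul]
  -- `e′⁻¹(u, r) = e⁻¹(φ⁻¹ u, 1) · r` for every `r ∈ K` (clause [10])
  have hsymm : ∀ (u : ↥(unitaryGroupOfForm (starRingEnd ℂ) J)) (r : ↥K),
      e'.symm (u, r) = e.symm (φ.symm u, 1) * (r : ↥(Subgroup.centralizer ({gprimeTorus L α S p} : Set ↥(arch (↥(maximalRealSubfield L)) L (IsCMField.complexConj L) 3 (Matrix.diagonal α))))) := fun u r => by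
    apply e'.injective
    rw [ContinuousMulEquiv.apply_symm_apply, map_mul, he', he', ContinuousMulEquiv.apply_symm_apply, ContinuousMulEquiv.apply_symm_apply, h10 _ r.2]
    ext <;> simp
  -- ONE ambient cut-off `χ ≡ 1` on the common compact matrix support of all the block test functions
  have hS₀ : IsCompact ((fun u : ↥(unitaryGroupOfForm (starRingEnd ℂ) J) => ((u : GL (Fin 2) ℂ) : Matrix (Fin 2) (Fin 2) ℂ)) '' (Prod.fst '' (e' '' tsupport
      (fun m : ↥(Subgroup.centralizer ({gprimeTorus L α S p} : Set ↥(arch (↥(maximalRealSubfield L)) L (IsCMField.complexConj L) 3 (Matrix.diagonal α)))) =>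
        ∫ x, β x • a' (x * (m : ↥(arch (↥(maximalRealSubfield L)) L (IsCMField.complexConj L) 3 (Matrix.diagonal α))) * x⁻¹) ∂ν')))) :=
    (((haMs.isCompact.image e'.continuous).image continuous_fst).image (Units.continuous_val.comp continuous_subtype_val))
  obtain ⟨χ, hχd, hχc, hχ1, -⟩ := Literature.Analysis.Calculus.exists_contDiff_hasCompactSupport_eq_one_of_isCompact hS₀
  -- the tangential spectator `c ↦ ↑↑γ_{update c w₀ (0, c_{w₀1}, 0)}` is smooth
  have hupd : ContDiff ℝ ∞ fun c : {w : InfinitePlace L // IsComplex w} → Fin 3 → ℝ => Function.update c w₀ (![0, c w₀ 1, 0] : Fin 3 → ℝ) := by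
    refine contDiff_pi.2 fun w => ?_
    rcases eq_or_ne w w₀ with rfl | hw
    · simp only [Function.update_self]
      refine contDiff_pi.2 fun i => ?_
      fin_cases i
      · exact contDiff_const
      · exact contDiff_apply_apply ℝ ℝ w 1
      · exact contDiff_const
    · simp only [Function.update_of_ne hw]
      exact contDiff_apply ℝ (Fin 3 → ℝ) w
  have hRρ : ContDiff ℝ ∞ fun c : {w : InfinitePlace L // IsComplex w} → Fin 3 → ℝ =>
      (((gprimeTorus L α S (Function.update c w₀ (![0, c w₀ 1, 0] : Fin 3 → ℝ)) : ↥(arch (↥(maximalRealSubfield L)) L (IsCMField.complexConj L) 3 (Matrix.diagonal α))) :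
        GL (Fin 3) (mixedSpace L)) : Matrix (Fin 3) (Fin 3) (mixedSpace L)) := (contDiff_coe_gprimeTorus L α S).comp hupd
  -- the family
  obtain ⟨f, hf⟩ : ∃ f : ({w : InfinitePlace L // IsComplex w} → Fin 3 → ℝ) × Matrix (Fin 2) (Fin 2) ℂ → ℂ, f = fun q =>
      (χ q.2 : ℂ) * ΘM (Λ (((M₀⁻¹ : GL (Fin 2) ℂ) : Matrix (Fin 2) (Fin 2) ℂ) * q.2 * ((M₀ : GL (Fin 2) ℂ) : Matrix (Fin 2) (Fin 2) ℂ)) *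
        (((gprimeTorus L α S (Function.update q.1 w₀ (![0, q.1 w₀ 1, 0] : Fin 3 → ℝ)) : ↥(arch (↥(maximalRealSubfield L)) L (IsCMField.complexConj L) 3 (Matrix.diagonal α))) :
          GL (Fin 3) (mixedSpace L)) : Matrix (Fin 3) (Fin 3) (mixedSpace L))) := ⟨_, rfl⟩
  have hfs : ContDiff ℝ ∞ f := by
    rw [hf]
    refine ((Complex.ofRealCLM.contDiff.comp ((hχd ⊤).comp contDiff_snd)).mul
      (hΘM.comp (((hΛ.comp ((contDiff_const.mul contDiff_snd).mul contDiff_const)).mul (hRρ.comp contDiff_fst)))))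
  -- `f (c, ↑↑u) = (a′)_M^β (e′⁻¹(u, (e γ_c).2))` for every `c`, `u`
  have hfB : ∀ (c : {w : InfinitePlace L // IsComplex w} → Fin 3 → ℝ) (u : ↥(unitaryGroupOfForm (starRingEnd ℂ) J)),
      (fun m : ↥(Subgroup.centralizer ({gprimeTorus L α S p} : Set ↥(arch (↥(maximalRealSubfield L)) L (IsCMField.complexConj L) 3 (Matrix.diagonal α)))) =>
        ∫ x, β x • a' (x * (m : ↥(arch (↥(maximalRealSubfield L)) L (IsCMField.complexConj L) 3 (Matrix.diagonal α))) * x⁻¹) ∂ν')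
        (e'.symm (u, (e ⟨gprimeTorus L α S c, gprimeTorus_mem_centralizer L α S p c⟩).2)) = f (c, ((u : GL (Fin 2) ℂ) : Matrix (Fin 2) (Fin 2) ℂ)) := by
    intro c u
    have haM' := congrFun haM (e'.symm (u, (e ⟨gprimeTorus L α S c, gprimeTorus_mem_centralizer L α S p c⟩).2))
    beta_reduce at haM'
    beta_reduce
    -- the smooth reading of the value
    have hread : ΘM ((((e'.symm (u, (e ⟨gprimeTorus L α S c, gprimeTorus_mem_centralizer L α S p c⟩).2) :
        ↥(Subgroup.centralizer ({gprimeTorus L α S p} : Set ↥(arch (↥(maximalRealSubfield L)) L (IsCMField.complexConj L) 3 (Matrix.diagonal α))))) :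
          ↥(arch (↥(maximalRealSubfield L)) L (IsCMField.complexConj L) 3 (Matrix.diagonal α))) : GL (Fin 3) (mixedSpace L)) : Matrix (Fin 3) (Fin 3) (mixedSpace L)) =
        ΘM (Λ (((M₀⁻¹ : GL (Fin 2) ℂ) : Matrix (Fin 2) (Fin 2) ℂ) * ((u : GL (Fin 2) ℂ) : Matrix (Fin 2) (Fin 2) ℂ) * ((M₀ : GL (Fin 2) ℂ) : Matrix (Fin 2) (Fin 2) ℂ)) *
          (((gprimeTorus L α S (Function.update c w₀ (![0, c w₀ 1, 0] : Fin 3 → ℝ)) : ↥(arch (↥(maximalRealSubfield L)) L (IsCMField.complexConj L) 3 (Matrix.diagonal α))) :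
            GL (Fin 3) (mixedSpace L)) : Matrix (Fin 3) (Fin 3) (mixedSpace L))) := by
      rw [hsymm, Subgroup.coe_mul, Subgroup.coe_mul, Units.val_mul, hΛb' (φ.symm u), hφsymm u, h6 c]
    by_cases hu : (e'.symm (u, (e ⟨gprimeTorus L α S c, gprimeTorus_mem_centralizer L α S p c⟩).2)) ∈ tsupport
        (fun m : ↥(Subgroup.centralizer ({gprimeTorus L α S p} : Set ↥(arch (↥(maximalRealSubfield L)) L (IsCMField.complexConj L) 3 (Matrix.diagonal α)))) =>
          ∫ x, β x • a' (x * (m : ↥(arch (↥(maximalRealSubfield L)) L (IsCMField.complexConj L) 3 (Matrix.diagonal α))) * x⁻¹) ∂ν')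
    · have hχu : χ ((u : GL (Fin 2) ℂ) : Matrix (Fin 2) (Fin 2) ℂ) = 1 :=
        hχ1 _ ⟨u, ⟨(u, (e ⟨gprimeTorus L α S c, gprimeTorus_mem_centralizer L α S p c⟩).2), ⟨_, hu, e'.apply_symm_apply _⟩, rfl⟩, rfl⟩
      rw [hf]
      beta_reduce
      rw [hχu, Complex.ofReal_one, one_mul, haM', hread]
    · have h0 := image_eq_zero_of_notMem_tsupport hu
      beta_reduce at h0
      have h0' := h0
      rw [haM', hread] at h0'
      rw [h0, hf]
      beta_reduce
      rw [h0', mul_zero]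
  -- ### the descent constant `K = dt′(B′)·κ ≠ 0`
  have hdtS := toReal_chartHaarG_chartBoxImgG_pos L α S hα hS
  have hK0 : (((chartHaarG L α S (chartBoxImgG L α S)).toReal : ℂ) * ((κ : ℝ) : ℂ)) ≠ 0 :=
    mul_ne_zero (Complex.ofReal_ne_zero.2 hdtS.ne') (Complex.ofReal_ne_zero.2 (NNReal.coe_ne_zero.2 hκ))
  -- ### integrability at regular chart points (★ p850485)
  letI : MeasurableSpace (↥(arch (↥(maximalRealSubfield L)) L (IsCMField.complexConj L) 3 (Matrix.diagonal α)) ⧸ chartTorusG L α S) := borel _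
  haveI : BorelSpace (↥(arch (↥(maximalRealSubfield L)) L (IsCMField.complexConj L) 3 (Matrix.diagonal α)) ⧸ chartTorusG L α S) := ⟨rfl⟩
  haveI := isMulLeftInvariant_chartHaarG L α S
  haveI := isFiniteMeasureOnCompacts_chartHaarG L α S
  haveI := isOpenPosMeasure_chartHaarG L α S
  have hq : chartQuotientMeasureG L α ν' S = quotientMeasure (chartTorusG L α S) (chartHaarG L α S) (isClosed_chartTorusG L α S) ν' := rfl
  haveI : IsFiniteMeasureOnCompacts (chartQuotientMeasureG L α ν' S) := by rw [hq]; infer_instance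
  -- ### the block reading of `γ_c` through `e′` ([5] + (B-STD) (i))
  have hγ : ∀ c : {w : InfinitePlace L // IsComplex w} → Fin 3 → ℝ,
      e' ⟨gprimeTorus L α S c, hT (gprimeTorus_mem_chartTorusG L α S c)⟩ =
        ((⟨Matrix.GeneralLinearGroup.mkOfDetNeZero !![(1 : ℂ), 1; 1, -1] det_cayleyTwo_ne_zero *
            circleDiagonal 2 ![Circle.exp (c w₀ 0), Circle.exp (c w₀ 2)] *
            (Matrix.GeneralLinearGroup.mkOfDetNeZero !![(1 : ℂ), 1; 1, -1] det_cayleyTwo_ne_zero)⁻¹, cayley_conj_circleDiagonal_mem_of_eq_over hJ _⟩ : ↥(unitaryGroupOfForm (starRingEnd ℂ) J)),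
          (e ⟨gprimeTorus L α S c, gprimeTorus_mem_centralizer L α S p c⟩).2) := by
    intro c
    have h1 : (e ⟨gprimeTorus L α S c, gprimeTorus_mem_centralizer L α S p c⟩).1 =
        ⟨circleDiagonal 2 ![Circle.exp (c w₀ 0), Circle.exp (c w₀ 2)],
          circleDiagonal_mem_unitaryGroupOfForm_diagonal_map_weights w₀.1.embedding ![α (lineOf (formSign L α w₀) 0), α (lineOf (formSign L α w₀) 2)] _⟩ :=
      Subtype.ext (h5 c)
    rw [he', h1, hφ]
  -- ### assembling
  refine ⟨(((chartHaarG L α S (chartBoxImgG L α S)).toReal : ℂ) * ((κ : ℝ) : ℂ)), U, f, hK0, hUo, hpU, hfs, ⟨tsupport χ, hχc, fun c X hX => ?_⟩, fun c X => ?_, ?_⟩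
  · rw [hf]; dsimp only; rw [image_eq_zero_of_notMem_tsupport hX, Complex.ofReal_zero, zero_mul]
  · rw [hf]; dsimp only; rw [Function.update_idem, Function.update_self]
    simp
  rintro c ⟨hcU, hcreg⟩
  have hint := integrable_descConj_gprimeTorus_of_regG L α S hα hS hcreg ha'c ha's (chartQuotientMeasureG L α ν' S)
  rw [chartOrbG_eq_integral_descended_of_cutoff L α ν' S a' ha'c (gprimeTorus L α S p) νM hT hβc hβs hβ0 hβ1S c hint (hCM c hcU),
    integral_descConj_eq_smul_integral_of_block _ _ e' Ψ hΨ _ μ₀ hmap _ _ _ (hγ c) _ haMc, NNReal.smul_def, Complex.real_smul, ← mul_assoc]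
  congr 1
  refine integral_congr_ae (Filter.Eventually.of_forall fun b => ?_)
  exact hfB c _

end Chart

end Literature.NumberTheory.Rogawski1990

end
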